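import Summits.NavierStokesRegularity.FluidComputer.GateBudgetColdCredit
import Summits.NavierStokesRegularity.FluidComputer.GateBudgetLadderSharp
import Summits.NavierStokesRegularity.FluidComputer.GateBudgetRungBalance
import HarnessLib

/-!
# GateBudget part 94 — the balanced ladder: the climb with no clock window (§268)

Cell `pub-fluidc`, blueprint seat bp1 (gen 37 close-out, SPEC-INPUT-bp1 §BS(3): "part 88 with
the clock coordinate swapped"); namespace `Summit.NavierStokesRegularity.FluidComputer.GateBudget`,
headline member `RotorKnob.rotorCircuit K K¹⁰ ε ρ` of the two-scale family from `delayInit`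
(5.6), `K ≥ 16`, on the lattice window `200ε/K²⁰ ≤ ρ² ≤ 2ε/K¹⁰`, `ε² ≤ 1/(6K²⁰)`, `ε = kK¹⁰ρ²`;
modes `0 = a` (carrier), `1 = b` (clock), `2 = c` (trigger), `3 = d` (transfer), `4 = ã`
(output). HONEST FRAMING: a low prior, high value-of-information experiment on Tao's machine
paradigm; NOT a claim that NS blows up.

WHAT. Part 88 §257 `knob_ladder_climb_sharp` climbs the misfire ladder charging the clock a
bookkeeping loss `L ≥ 242 log K/K¹⁰ + 37(D + ι + 4/K⁹)/K⁹` per rung, so it needs the CLOCK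
WINDOW `5/4 + (N - 1)L ≤ θ₀`, `(N - 1)L ≤ 0.14999` — at part 89's `L ≤ 42/K⁹` that is `N - 1 ≤
3.428·10⁻³K⁹`, below the pair window `0.0199K⁹/(1.1 + k²/10)` for small `k`. §268
`knob_ladder_climb_balance` is part 88 §257 LINE BY LINE with the clock coordinate swapped: the
pulse half is part 90 §261 `knob_pulse_debit` (part 84 §246 plus THE DEBIT), the cold half is
part 92 §265 `knob_cold_credit` (part 87 §255 plus THE CREDIT) whenever the pulse exits in the
credit band `θ₁ ≤ 1.39`, else part 87 §255 itself, and the clock invariant is part 93 §267's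
capped square: `1.39² - 2.78L ≤ min(θₙ², 1.39²) + F(ã(rₙ)) + (n - 1)c`, `F(e) = (723 log
K/K¹⁰ + 1.972)e² + (3 + 10⁻⁶)e/K`, `c = 21ε² + 10⁻⁶/K¹⁰ + 1/K¹⁸ + 6/K⁴⁰`. In the band the
debit and the credit CANCEL up to the telescoping `F` (part 93 §266 `rung_balance_in_band`);
out of the band part 87's dichotomy refills the square (§266 `out_band_floor`); and §267
`ladder_clock_floor` regenerates `θₙ ≥ 5/4` at every rung from the invariant ALONE. Hence the
hypotheses: part 88's anchor, ledgers and pair budget `P₁ + s′ + (N - 1)S ≤ 1/50` VERBATIM, the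
clock start `1.39 - L ≤ θ₀ ≤ 29/20`, and in place of the clock window only `L ≤ 42/K⁹` (part
89 §258) and `N - 1 ≤ K⁹` (fifty times the pair window): THE CLOCK WINDOW IS GONE — the clean
dud horizon is PAIR-limited for every `k` and every `K ≥ 16`. Conclusion: part 88's, with
`5/4 ≤ θₙ ≤ 29/20` flat and the capped-square invariant exported.
HOW. The induction of part 88 §257 with: `hθ1` read off the invariant; the pulse half by
§261; the exit budget `P(T') ≤ 1/50` as in part 88; a case split on `θ₁ ≤ 1.39` choosing §265
or §255 and proving the next invariant by §266/§267; the pair slip, the three transfer ledgers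
and the output floor untouched; `θₙ₊₁ ≥ 5/4` by §267 `ladder_clock_floor` with `m ≤ N - 1 ≤
K⁹` rungs behind.
HONEST LIMITS. (i) existence per rung, no uniqueness; (ii) `A₀, D₀, P₁, D, U, S, L` free under
part 88's dominations; the PAIR budget still caps the ladder (`N - 1 ≤ 0.0199K⁹/(1.1 + k²/10)`
at part 86's ledgers) — the output floor `ã ≥ (n - 1)/K⁹` against `ã² ≤ P ≤ 1/50` is the true
ceiling `0.1415K⁹` (part 72) and is NOT reached here; (iii) the anchor must sit at `θ₀ ≥ 1.39 -
L` (the first pin of part 51 does: `θ ≈ √2`); (iv) nothing about Navier–Stokes.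
[cite: Tao2016AveragedNS, §5.5 Theorem 5.3, (5.5), (5.6), (b-eq), (c-eq), (d-eq), (ta-eq),
(energy-con), (est)]
-/

noncomputable section

namespace Summit.NavierStokesRegularity.FluidComputer.GateBudget

open Real Set Filter Topology
open Literature.Analysis.FluidPDE.Tao2016AveragedNS

variable {K ε ρ : ℝ} {X : ℝ → Fin 5 → ℝ} {C : ℝ → ℝ}

/-! ## §268 The balanced climb -/

/-- §268 **THE BALANCED CLIMB** (headline member from `delayInit` with a trigger primitive `C`,
`K ≥ 16`, `0 < ε`, `ε² ≤ 1/(6K²⁰)`, `0 < ρ`, `200ε/K²⁰ ≤ ρ²`, `K¹⁰ρ² ≤ 2ε`, `ε = kK¹⁰ρ²`).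
Part 88 §257's anchor `r₀ ≥ 0` in normal form, ledgers `D, U, S`, sharp loss `L ≥ 242 log
K/K¹⁰ + 37(D + ι + 4/K⁹)/K⁹` and pair budget `P₁ + s′ + (N - 1)S ≤ 1/50` VERBATIM; the clock
start `1.39 - L ≤ θ₀ ≤ 29/20`; NO CLOCK WINDOW — only `L ≤ 42/K⁹` and `N - 1 ≤ K⁹`. THEN for
every `1 ≤ n ≤ N` a normal-form ignition `rₙ ≥ r₀ + (n - 1)` with `5/4 ≤ θₙ ≤ 29/20`, `P(rₙ) ≤
P₁ + (n - 1)S`, `A₀ + (n - 1)/K⁹ ≤ ã(rₙ)`, part 81 §238's transfer invariants, and the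
capped-square clock invariant `1.39² - 2.78L ≤ min(θₙ², 1.39²) + F(ã(rₙ)) + (n - 1)c`.
[derived: part 90 §261, part 92 §265, part 87 §255, part 93 §266–§267, part 88 §257] -/
theorem knob_ladder_climb_balance
    (hX : ∀ t, HasDerivAt X (RotorKnob.rotorCircuit K (K ^ 10) ε ρ (X t)) t)
    (h0 : X 0 = delayInit) (hC : ∀ t, HasDerivAt C (X t 2) t) (hK : 16 ≤ K)
    (hε : 0 < ε) (hεK : ε ^ 2 ≤ 1 / (6 * K ^ 20)) (hρ : 0 < ρ)
    (hlo : 200 * ε / K ^ 20 ≤ ρ ^ 2) (hhi : K ^ 10 * ρ ^ 2 ≤ 2 * ε) (k : ℕ)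
    (hk : ε = k * K ^ 10 * ρ ^ 2) {r₀ θ₀ P₁ A₀ D₀ D U S L : ℝ} {N : ℕ} (hr₀ : 0 ≤ r₀)
    (hb₀ : X r₀ 1 = θ₀ * ε) (hc₀ : X r₀ 2 = ρ ^ 2 / K ^ 9) (hP₁ : X r₀ 3 ^ 2 + X r₀ 4 ^ 2 ≤ P₁)
    (hθ₀lo : 139 / 100 - L ≤ θ₀) (hθ₀hi : θ₀ ≤ 29 / 20)
    (hL42 : L ≤ 42 / K ^ 9) (hN9 : (N : ℝ) - 1 ≤ K ^ 9)
    (hA0 : 0 ≤ A₀) (hA₀ : A₀ ≤ X r₀ 4) (hD₀ : |X r₀ 3| ≤ D₀)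
    (hD : D₀ + (1 + 10 / 9 * K ^ 4) * ((61 / 12 * k + 2 / 3) / K ^ 10 + 3 / K ^ 9) ≤ D)
    (hU : 7 / 2 + k ^ 2 / 3 + (2 * log k + 520 * log K) * D ^ 2 ≤ U)
    (hS : (2829 / 10000 + U / K ^ 9) * (U / K ^ 9)
      + (2 * D + (2 * k + 3) / (5 * K ^ 9)) * ((2 * k + 3) / (5 * K ^ 9))
      + 6 * (D + (2 * k + 3) / (5 * K ^ 9) + 3 / K ^ 9) / K ^ 9 ≤ S)
    (hL : 242 * log K / K ^ 10 + 37 * (D + (2 * k + 3) / (5 * K ^ 9) + 4 / K ^ 9) / K ^ 9 ≤ L)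
    (hNP : P₁ + (3 * (k * π / ((25 / 16 - 1 / 10 ^ 6) * K ^ 10 - 1) + 1 / K ^ 19
      + 310 * log K / K ^ 9) / 10 + 6 / K ^ 9) + ((N : ℝ) - 1) * S ≤ 1 / 50) :
    ∀ n : ℕ, 1 ≤ n → n ≤ N → ∃ r θ : ℝ, r₀ + ((n : ℝ) - 1) ≤ r ∧ X r 1 = θ * ε ∧
      5 / 4 ≤ θ ∧ θ ≤ 29 / 20 ∧
      X r 2 = ρ ^ 2 / K ^ 9 ∧
      X r 3 ^ 2 + X r 4 ^ 2 ≤ P₁ + ((n : ℝ) - 1) * S ∧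
      A₀ + ((n : ℝ) - 1) / K ^ 9 ≤ X r 4 ∧
      |X r 3| ≤ D₀ + ((n : ℝ) - 1) * ((61 / 12 * k + 2 / 3) / K ^ 10 + 3 / K ^ 9) ∧
      |X r 3| ≤ D₀ + (1 + 10 / 9 * K ^ 8 / n) * ((61 / 12 * k + 2 / 3) / K ^ 10 + 3 / K ^ 9) ∧
      (139 / 100) ^ 2 - 278 / 100 * L ≤ min (θ ^ 2) ((139 / 100) ^ 2)
        + ((723 * log K / K ^ 10 + 1972 / 1000) * X r 4 ^ 2 + (3 + 1 / 10 ^ 6) * X r 4 / K)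
        + ((n : ℝ) - 1) * (21 * ε ^ 2 + 1 / (10 ^ 6 * K ^ 10) + 1 / K ^ 18 + 6 / K ^ 40) := by
  obtain ⟨hk1, -, -, hδ0, -, -⟩ := rung_numerics hK hε hρ hlo k hk
  have hK0 : (0 : ℝ) < K := by linarith
  have hK8 : (0 : ℝ) < K ^ 8 := by positivity
  have hK9 : (0 : ℝ) < K ^ 9 := by positivity
  have hK10 : (0 : ℝ) < K ^ 10 := by positivity
  have hk0 : (0 : ℝ) ≤ k := Nat.cast_nonneg k
  have hlogK : 0 ≤ log K := Real.log_nonneg (by linarith)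
  have h310 : (0 : ℝ) ≤ 310 * log K / K ^ 9 := div_nonneg (by positivity) hK9.le
  have h6 : (0 : ℝ) ≤ 6 / K ^ 9 := by positivity
  have h3 : (0 : ℝ) ≤ 3 / K ^ 9 := by positivity
  have hD0 : 0 ≤ D₀ := le_trans (abs_nonneg _) hD₀
  obtain ⟨s, hs_def⟩ : ∃ s : ℝ, s = 3 * (k * π / ((25 / 16 - 1 / 10 ^ 6) * K ^ 10 - 1)
      + 1 / K ^ 19 + 310 * log K / K ^ 9) / 10 + 6 / K ^ 9 := ⟨_, rfl⟩
  have hs0 : 0 ≤ s := by rw [hs_def]; linarith only [hδ0, h310, h6]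
  obtain ⟨J, hJ_def⟩ : ∃ J : ℝ, J = (61 / 12 * k + 2 / 3) / K ^ 10 + 3 / K ^ 9 := ⟨_, rfl⟩
  have hJ0 : 0 ≤ J := by rw [hJ_def]; positivity
  obtain ⟨ι, hι_def⟩ : ∃ ι : ℝ, ι = (2 * k + 3) / (5 * K ^ 9) := ⟨_, rfl⟩
  have hι0 : 0 ≤ ι := by rw [hι_def]; positivity
  obtain ⟨hDnn, -, hS0⟩ := clock_slip_signs hK hk1 hD0 hD hU hS
  obtain ⟨hfine0, hfine6, -, hl0⟩ := sharp_clock_signs hK hDnn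
    (by positivity : (0 : ℝ) ≤ (2 * k + 3) / (5 * K ^ 9)) hL
  have hlogc : 0 ≤ 2 * log k + 520 * log K := by
    have : 0 ≤ log (k : ℝ) := Real.log_nonneg hk1
    linarith only [this, hlogK]
  -- the balance bookkeeping of part 93 (§266–§267), abbreviated
  obtain ⟨A, hA_def⟩ : ∃ A : ℝ, A = 723 * log K / K ^ 10 + 1972 / 1000 := ⟨_, rfl⟩
  obtain ⟨c, hc_def⟩ : ∃ c : ℝ,
      c = 21 * ε ^ 2 + 1 / (10 ^ 6 * K ^ 10) + 1 / K ^ 18 + 6 / K ^ 40 := ⟨_, rfl⟩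
  obtain ⟨hA723, hc0, -⟩ := ladder_balance_numerics hK hεK le_rfl hK9.le hL42
  rw [← hc_def] at hc0
  have hApos : 0 ≤ A := by rw [hA_def]; linarith only [hA723]
  have hLs : L ≤ 1 / 10 ^ 6 := by
    have hK9' : (16 : ℝ) ^ 9 ≤ K ^ 9 := pow_le_pow_left₀ (by norm_num) hK 9
    have h1 : 42 / K ^ 9 ≤ 42 / 16 ^ 9 := div_le_div_of_nonneg_left (by norm_num) (by norm_num) hK9'
    norm_num at h1
    linarith only [hL42, h1]
  have numer : ∀ m' : ℝ, 0 ≤ m' → m' ≤ K ^ 9 →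
      25 / 16 + (A * (1 / 50) + (3 + 1 / 10 ^ 6) * (1415 / 10000) / K) + m' * c
        ≤ (139 / 100) ^ 2 - 278 / 100 * L := by
    intro m' h0' h9'
    have := (ladder_balance_numerics hK hεK h0' h9' hL42).2.2
    rwa [← hA_def, ← hc_def] at this
  have floor : ∀ {θ e m' : ℝ},
      (139 / 100) ^ 2 - 278 / 100 * L ≤ min (θ ^ 2) ((139 / 100) ^ 2)
        + (A * e ^ 2 + (3 + 1 / 10 ^ 6) * e / K) + m' * c →
      25 / 16 + (A * (1 / 50) + (3 + 1 / 10 ^ 6) * (1415 / 10000) / K) + m' * c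
        ≤ (139 / 100) ^ 2 - 278 / 100 * L →
      0 < θ → 0 ≤ e → e ^ 2 ≤ 1 / 50 → 5 / 4 ≤ θ := by
    intro θ e m' hinv hnum hθ he he2
    rw [hA_def, hc_def] at hinv hnum
    exact ladder_clock_floor hK hinv hnum hA723 hθ he he2
  simp only [← hs_def, ← hJ_def, ← hι_def, ← hA_def, ← hc_def] at hNP hD hS hL ⊢
  have hcold6 : 0 ≤ 6 * (D + ι + 3 / K ^ 9) / K ^ 9 :=
    div_nonneg (mul_nonneg (by norm_num) (by linarith only [hDnn, hι0, h3])) hK9.le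
  intro n hn
  induction n, hn using Nat.le_induction with
  | base =>
    intro _
    have he₀ : 0 ≤ X r₀ 4 := hA0.trans hA₀
    have hF0 : 0 ≤ A * X r₀ 4 ^ 2 + (3 + 1 / 10 ^ 6) * X r₀ 4 / K :=
      add_nonneg (mul_nonneg hApos (sq_nonneg _))
        (div_nonneg (mul_nonneg (by norm_num) he₀) hK0.le)
    have hinv₀ := capped_step_out_band hl0 (by linarith only [hLs]) hθ₀lo hF0
    refine ⟨r₀, θ₀, by simp, hb₀, by linarith only [hθ₀lo, hLs], hθ₀hi, hc₀, by simpa using hP₁,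
      by simpa using hA₀, by simpa using hD₀, ?_, ?_⟩
    · have : 0 ≤ (1 + 10 / 9 * K ^ 8) * J := mul_nonneg (by positivity) hJ0
      norm_num; linarith only [hD₀, this]
    · norm_num at hinv₀ ⊢; linarith only [hinv₀]
  | succ m hm ih =>
    intro hmN
    obtain ⟨r, θ, hr, hb, hθ1, hθhi, hc, hP, hA, hd1, hd2, hinv⟩ := ih (Nat.le_of_succ_le hmN)
    have hm1 : (1 : ℝ) ≤ m := by exact_mod_cast hm
    have hmN' : (m : ℝ) + 1 ≤ N := by exact_mod_cast hmN
    have hmK9 : (m : ℝ) ≤ K ^ 9 := by linarith only [hmN', hN9]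
    have hr0 : 0 ≤ r := by linarith only [hr₀, hr, hm1]
    have hmS : ((m : ℝ) - 1) * S ≤ ((N : ℝ) - 1) * S - S := by
      have := mul_nonneg (sub_nonneg.2 hmN') hS0
      linarith only [this]
    have hP50 : X r 3 ^ 2 + X r 4 ^ 2 + s ≤ 1 / 50 := by linarith only [hP, hNP, hmS, hS0]
    have hPr : X r 3 ^ 2 + X r 4 ^ 2 + 3 * (k * π / ((25 / 16 - 1 / 10 ^ 6) * K ^ 10 - 1)
        + 1 / K ^ 19 + 310 * log K / K ^ 9) / 10 + 6 / K ^ 9 ≤ 1 / 50 := by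
      rw [hs_def] at hP50; linarith only [hP50]
    -- the pulse half WITH THE DEBIT (part 90 §261)
    obtain ⟨T', θ₁, ⟨hrT, -, -, -, hbT, hθ₁lo, hθ₁hi, hfloor, hcT, -, he0, hecr, hfl, hceil,
        hdT⟩, hΛlo, hΛhi, hdebit⟩ :=
      knob_pulse_debit hX h0 hC hK hε hεK hρ hlo hhi k hk hr0 hθ1 hθhi hb hc hPr
    have hT'0 : 0 ≤ T' := by linarith only [hr0, hrT]
    have em1 : ((m : ℝ) - 1) + 1 = m := by ring
    -- the pulse P-slip on the ledgers (part 82 §239), as in part 88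
    have hdD : |X r 3| ≤ D :=
      (ledger_invariant_final hK0 hJ0 (by linarith only [hm1]) hd1 (by rw [em1]; exact hd2)).trans
        hD
    have ha0 : 0 ≤ X r 4 :=
      le_trans (add_nonneg hA0 (div_nonneg (by linarith only [hm1]) hK9.le)) hA
    have haP : X r 4 ^ 2 ≤ 1 / 50 := by nlinarith only [hP50, hs0, sq_nonneg (X r 3)]
    have heT : K * X T' 4 ≤ 3 / 20 * K := by
      have h2a : X r 4 ≤ 1415 / 10000 := by nlinarith only [haP, ha0]
      have : X T' 4 ≤ 3 / 20 := by linarith only [hecr, pulse_gain_crude hK, h2a]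
      nlinarith only [this, hK0]
    obtain ⟨-, hι⟩ := iota_numerics hK hk0 (mul_nonneg hK0.le he0) heT
    rw [← hι_def] at hι
    have hdT' : |X T' 3| ≤ |X r 3| + ι := by linarith only [hdT, hι]
    have hd2D : X r 3 ^ 2 ≤ D ^ 2 := by
      have := pow_le_pow_left₀ (abs_nonneg _) hdD 2
      rwa [sq_abs] at this
    have hUr : 7 / 2 + k ^ 2 / 3 + (2 * log k + 520 * log K) * X r 3 ^ 2 ≤ U := by
      have := mul_le_mul_of_nonneg_left hd2D hlogc
      linarith only [this, hU]
    have haT' : X T' 4 ≤ X r 4 + U / K ^ 9 := by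
      linarith only [hceil, div_le_div_of_nonneg_right hUr hK9.le]
    have haa' : X r 4 ≤ X T' 4 := by
      have : (0 : ℝ) < 1 / K ^ 9 := by positivity
      linarith only [hfl, this]
    have slip := pulse_pslip ha0 haP haT' haa' hdT' hdD hι0
    -- the exit budget `P(T') ≤ 1/50` and the exit clock `1.249 ≤ θ₁ ≤ 3/2`, as in part 88
    have hPT : X T' 3 ^ 2 + X T' 4 ^ 2 ≤ 1 / 50 := by
      linarith only [slip, hS, hcold6, hP, hNP, hmS, hs0]
    have hθ₁1 : 1249 / 1000 ≤ θ₁ := by linarith only [hθ₁lo, hθ1, hfine6]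
    have hθ₁2 : θ₁ ≤ 3 / 2 := by linarith only [hθ₁hi, hθhi, hfine6]
    -- the sharp debt `37(|d(T')| + 4/K⁹)/K⁹ ≤ 37(D + ι + 4/K⁹)/K⁹ ≤ L`
    have h37 : 37 * (|X T' 3| + 4 / K ^ 9) / K ^ 9 ≤ L := by
      have h := div_le_div_of_nonneg_right (show 37 * (|X T' 3| + 4 / K ^ 9)
        ≤ 37 * (D + ι + 4 / K ^ 9) by linarith only [hdT', hdD]) hK9.le
      linarith only [h, hL, hfine0]
    -- THE COLD HALF: part 92 §265 (credit band `θ₁ ≤ 1.39`) or part 87 §255 (out of band),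
    -- each with the next capped-square invariant (part 93 §266–§267)
    obtain ⟨tz, r', θ', ⟨htz1, -, htz2, hr'3, hcold, hc'⟩, ⟨hb', hθ'hi, hθ'lo, hpair⟩,
        ⟨-, hdr', hmono, -, -⟩, hclk⟩ :
        ∃ tz r' θ' : ℝ, (T' + 1 ≤ tz ∧ X tz 1 = 0 ∧ tz < r' ∧ r' < T' + 3 ∧
          (∀ t ∈ Icc T' r', X t 2 ≤ ρ ^ 2 / K ^ 9) ∧ X r' 2 = ρ ^ 2 / K ^ 9) ∧
          (X r' 1 = θ' * ε ∧ θ' ≤ 141422 / 100000 ∧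
            (θ₁ - 37 * (|X T' 3| + 4 / K ^ 9) / K ^ 9 ≤ θ' ∨ 139999 / 100000 ≤ θ') ∧
            |X r' 3 ^ 2 + X r' 4 ^ 2 - (X T' 3 ^ 2 + X T' 4 ^ 2)|
              ≤ 6 * (|X T' 3| + 3 / K ^ 9) / K ^ 9) ∧
          (9 / 4 ≤ r' - T' ∧ |X r' 3| ≤ |X T' 3| * exp (-(9 / 4 * (K * X T' 4))) + 3 / K ^ 9 ∧
            X T' 4 ≤ X r' 4 ∧ X r' 4 ≤ X T' 4 + 3 * K * (|X T' 3| + 3 / K ^ 9) ^ 2 ∧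
            ∀ t ∈ Icc T' r', |X t 3| ≤ |X T' 3| + 3 / K ^ 9) ∧
          (139 / 100) ^ 2 - 278 / 100 * L ≤ min (θ' ^ 2) ((139 / 100) ^ 2)
            + (A * X r' 4 ^ 2 + (3 + 1 / 10 ^ 6) * X r' 4 / K) + (m : ℝ) * c := by
      rcases le_or_gt θ₁ (139 / 100) with hband | hband
      · -- in the credit band: debit + credit telescope (part 93 §266)
        obtain ⟨tz, r', θ', h1, h2, h3, -, -, hcredit⟩ :=
          knob_cold_credit hX h0 hK hε hεK hρ hhi hT'0 hθ₁1 hband hbT hPT hfloor hcT he0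
        refine ⟨tz, r', θ', h1, h2, h3, ?_⟩
        have hmo : X T' 4 ≤ X r' 4 := h3.2.2.1
        have hbal := rung_balance_in_band hK hdebit hcredit hΛlo hΛhi ha0 haa' hmo
        have hFm := balance_weight_mono hK ha0 (haa'.trans hmo) hc0
        rw [← hA_def, ← hc_def] at hbal
        rw [← hA_def] at hFm
        have step := capped_step_in_band (C := ((139 : ℝ) / 100) ^ 2) (θ2 := θ ^ 2)
          (θ'2 := θ' ^ 2)
          (F := A * X r 4 ^ 2 + (3 + 1 / 10 ^ 6) * X r 4 / K + ((m : ℝ) - 1) * c)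
          (F' := A * X r' 4 ^ 2 + (3 + 1 / 10 ^ 6) * X r' 4 / K + (m : ℝ) * c)
          (by linarith only [hbal]) (by linarith only [hFm])
        linarith only [step, hinv]
      · -- out of the band: part 87's dichotomy refills the square (part 93 §266–§267)
        obtain ⟨tz, r', θ', h1, h2, h3⟩ :=
          knob_cold_half_sharp hX h0 hK hε hεK hρ hhi hT'0 hθ₁1 hθ₁2 hbT hPT hfloor hcT he0
        refine ⟨tz, r', θ', h1, h2, h3, ?_⟩
        have hθ'L := out_band_floor hband hl0 h37 h2.2.2.1
        have he'0 : 0 ≤ X r' 4 := ha0.trans (haa'.trans h3.2.2.1)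
        have hF' : 0 ≤ A * X r' 4 ^ 2 + (3 + 1 / 10 ^ 6) * X r' 4 / K + (m : ℝ) * c :=
          add_nonneg (add_nonneg (mul_nonneg hApos (sq_nonneg _))
            (div_nonneg (mul_nonneg (by norm_num) he'0) hK0.le))
            (mul_nonneg (by linarith only [hm1]) hc0)
        have := capped_step_out_band hl0 (by linarith only [hLs]) hθ'L hF'
        linarith only [this]
    have hθ'pos : 0 < θ' := rung_exit_pos hθ₁1 (by linarith only [h37, hLs]) hθ'lo
    -- the pair slip of the rung, as in part 88
    have hcold' : 6 * (|X T' 3| + 3 / K ^ 9) / K ^ 9 ≤ 6 * (D + ι + 3 / K ^ 9) / K ^ 9 :=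
      div_le_div_of_nonneg_right (by linarith only [hdT', hdD]) hK9.le
    have hP's : X r' 3 ^ 2 + X r' 4 ^ 2 ≤ X r 3 ^ 2 + X r 4 ^ 2 + S := by
      have h1 := (abs_le.1 hpair).2
      linarith only [h1, hcold', slip, hS]
    -- the three ledger invariants (part 81 §238 verbatim), as in part 88
    obtain ⟨x, hx⟩ : ∃ x : ℝ, x = K * X T' 4 := ⟨_, rfl⟩
    have hmK : (m : ℝ) / K ^ 9 ≤ X T' 4 := by
      have e : ((m : ℝ) - 1) / K ^ 9 + 1 / K ^ 9 = (m : ℝ) / K ^ 9 := by ring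
      linarith only [hA, hfl, hA0, e]
    have hxm : (m : ℝ) / K ^ 8 ≤ x := by
      have e : K * ((m : ℝ) / K ^ 9) = (m : ℝ) / K ^ 8 := by field_simp
      rw [hx, ← e]; exact mul_le_mul_of_nonneg_left hmK hK0.le
    have hx0 : 0 ≤ x := le_trans (by positivity) hxm
    have hq0 : 0 ≤ exp (-(9 / 4 * x)) := (exp_pos _).le
    have hq1 : exp (-(9 / 4 * x)) ≤ 1 := by rw [Real.exp_le_one_iff]; linarith only [hx0]
    have hinj : exp (-(9 / 4 * x)) * (5 * k + (k / 2 + 4) * x) ≤ 61 / 12 * k + 2 / 3 := by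
      have f1 := mul_le_of_le_one_left (by positivity : (0 : ℝ) ≤ 5 * k) hq1
      have f2 := mul_le_mul_of_nonneg_left (injection_numerics x)
        (by positivity : (0 : ℝ) ≤ k / 2 + 4)
      linarith only [f1, f2]
    have hinj' : exp (-(9 / 4 * x)) * ((5 * k + (k / 2 + 4) * x) / K ^ 10)
        ≤ (61 / 12 * k + 2 / 3) / K ^ 10 := by
      rw [← mul_div_assoc]; exact div_le_div_of_nonneg_right hinj hK10.le
    rw [← hx] at hdT hdr'
    have hprod := mul_le_mul_of_nonneg_right hdT hq0
    have hrec : |X r' 3| ≤ exp (-(9 / 4 * x)) * |X r 3| + J := by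
      rw [hJ_def]; linarith only [hdr', hprod, hinj']
    have hy : 9 / 4 * (((m : ℝ) - 1) + 1) / K ^ 8 ≤ 9 / 4 * x := by
      rw [em1, mul_div_assoc]; linarith only [hxm]
    obtain ⟨hd1', hd2'⟩ := ledger_invariant_step hK0 hJ0 hD0 (abs_nonneg _)
      (by linarith only [hm1]) hy hd1 (by rw [em1]; exact hd2) hrec
    have em : ((m : ℝ) - 1) + 2 = (m : ℝ) + 1 := by ring
    rw [em] at hd2'
    -- the clock floor of the next rung from the invariant ALONE (part 93 §267)
    have he'0 : 0 ≤ X r' 4 := ha0.trans (haa'.trans hmono)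
    have hPr'50 : X r' 3 ^ 2 + X r' 4 ^ 2 ≤ 1 / 50 := by
      linarith only [hP's, hP, hmS, hNP, hs0]
    have he'2 : X r' 4 ^ 2 ≤ 1 / 50 := by nlinarith only [hPr'50, sq_nonneg (X r' 3)]
    have hθ'1 : 5 / 4 ≤ θ' := floor hclk (numer m (by positivity) hmK9) hθ'pos he'0 he'2

    refine ⟨r', θ', ?_, hb', hθ'1, by linarith only [hθ'hi], hc', ?_, ?_, ?_, ?_, ?_⟩
    · push_cast; linarith only [hr, hrT, htz1, htz2]
    · push_cast; linarith only [hP, hP's]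
    · have e' : (((m + 1 : ℕ) : ℝ) - 1) / K ^ 9 = ((m : ℝ) - 1) / K ^ 9 + 1 / K ^ 9 := by
        push_cast; ring
      linarith only [hA, hfl, hmono, e']
    · push_cast; linarith only [hd1']
    · push_cast; exact hd2'
    · push_cast
      have e' : ((m : ℝ) + 1 - 1) * c = (m : ℝ) * c := by ring
      rw [e']; exact hclk

/-- §268 **THE BALANCED LADDER, READ OUT**: under §268 `knob_ladder_climb_balance`'s hypotheses,
at every rung `1 ≤ n ≤ N` the ignition `rₙ ≥ r₀ + (n - 1)` is in normal form with `5/4 ≤ θₙ ≤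
29/20` and the pair is pinned from both sides, uniformly in `n`: `P(rₙ) ≤ P₁ + (n - 1)·S ≤
1/50`, `A₀ + (n - 1)/K⁹ ≤ ã(rₙ) ≤ 0.1415`, `|d(rₙ)| ≤ D` — part 88 §257's read-out with NO
clock window. [derived: this file §268, part 81 §237] -/
theorem knob_ladder_balance
    (hX : ∀ t, HasDerivAt X (RotorKnob.rotorCircuit K (K ^ 10) ε ρ (X t)) t)
    (h0 : X 0 = delayInit) (hC : ∀ t, HasDerivAt C (X t 2) t) (hK : 16 ≤ K)
    (hε : 0 < ε) (hεK : ε ^ 2 ≤ 1 / (6 * K ^ 20)) (hρ : 0 < ρ)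
    (hlo : 200 * ε / K ^ 20 ≤ ρ ^ 2) (hhi : K ^ 10 * ρ ^ 2 ≤ 2 * ε) (k : ℕ)
    (hk : ε = k * K ^ 10 * ρ ^ 2) {r₀ θ₀ P₁ A₀ D₀ D U S L : ℝ} {N : ℕ} (hr₀ : 0 ≤ r₀)
    (hb₀ : X r₀ 1 = θ₀ * ε) (hc₀ : X r₀ 2 = ρ ^ 2 / K ^ 9) (hP₁ : X r₀ 3 ^ 2 + X r₀ 4 ^ 2 ≤ P₁)
    (hθ₀lo : 139 / 100 - L ≤ θ₀) (hθ₀hi : θ₀ ≤ 29 / 20)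
    (hL42 : L ≤ 42 / K ^ 9) (hN9 : (N : ℝ) - 1 ≤ K ^ 9)
    (hA0 : 0 ≤ A₀) (hA₀ : A₀ ≤ X r₀ 4) (hD₀ : |X r₀ 3| ≤ D₀)
    (hD : D₀ + (1 + 10 / 9 * K ^ 4) * ((61 / 12 * k + 2 / 3) / K ^ 10 + 3 / K ^ 9) ≤ D)
    (hU : 7 / 2 + k ^ 2 / 3 + (2 * log k + 520 * log K) * D ^ 2 ≤ U)
    (hS : (2829 / 10000 + U / K ^ 9) * (U / K ^ 9)
      + (2 * D + (2 * k + 3) / (5 * K ^ 9)) * ((2 * k + 3) / (5 * K ^ 9))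
      + 6 * (D + (2 * k + 3) / (5 * K ^ 9) + 3 / K ^ 9) / K ^ 9 ≤ S)
    (hL : 242 * log K / K ^ 10 + 37 * (D + (2 * k + 3) / (5 * K ^ 9) + 4 / K ^ 9) / K ^ 9 ≤ L)
    (hNP : P₁ + (3 * (k * π / ((25 / 16 - 1 / 10 ^ 6) * K ^ 10 - 1) + 1 / K ^ 19
      + 310 * log K / K ^ 9) / 10 + 6 / K ^ 9) + ((N : ℝ) - 1) * S ≤ 1 / 50) :
    ∀ n : ℕ, 1 ≤ n → n ≤ N → ∃ r θ : ℝ, r₀ + ((n : ℝ) - 1) ≤ r ∧ X r 1 = θ * ε ∧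
      5 / 4 ≤ θ ∧ θ ≤ 29 / 20 ∧ X r 2 = ρ ^ 2 / K ^ 9 ∧
      X r 3 ^ 2 + X r 4 ^ 2 ≤ P₁ + ((n : ℝ) - 1) * S ∧ X r 3 ^ 2 + X r 4 ^ 2 ≤ 1 / 50 ∧
      A₀ + ((n : ℝ) - 1) / K ^ 9 ≤ X r 4 ∧ X r 4 ≤ 1415 / 10000 ∧ |X r 3| ≤ D := by
  intro n hn hnN
  obtain ⟨r, θ, hr, hb, hθ, hθhi, hc, hP, hA, hd1, hd2, -⟩ := knob_ladder_climb_balance hX h0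
    hC hK hε hεK hρ hlo hhi k hk hr₀ hb₀ hc₀ hP₁ hθ₀lo hθ₀hi hL42 hN9 hA0 hA₀ hD₀ hD hU hS hL
    hNP n hn hnN
  obtain ⟨hk1, -, -, hδ0, -, -⟩ := rung_numerics hK hε hρ hlo k hk
  have hK0 : (0 : ℝ) < K := by linarith
  have hK9 : (0 : ℝ) < K ^ 9 := by positivity
  have hn1 : (1 : ℝ) ≤ n := by exact_mod_cast hn
  have hnN' : (n : ℝ) ≤ N := by exact_mod_cast hnN
  obtain ⟨-, -, hS0⟩ := clock_slip_signs hK hk1 ((abs_nonneg _).trans hD₀) hD hU hS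
  have h310 : (0 : ℝ) ≤ 310 * log K / K ^ 9 :=
    div_nonneg (mul_nonneg (by norm_num) (Real.log_nonneg (by linarith))) hK9.le
  have hP50 : X r 3 ^ 2 + X r 4 ^ 2 ≤ 1 / 50 := by
    have h1 : ((n : ℝ) - 1) * S ≤ ((N : ℝ) - 1) * S :=
      mul_le_mul_of_nonneg_right (by linarith only [hnN']) hS0
    have h2 : (0 : ℝ) ≤ 6 / K ^ 9 := by positivity
    linarith only [hP, h1, hNP, hδ0, h310, h2]
  have ha0 : 0 ≤ X r 4 :=
    le_trans (add_nonneg hA0 (div_nonneg (by linarith only [hn1]) hK9.le)) hA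
  have ha : X r 4 ≤ 1415 / 10000 := by nlinarith only [hP50, ha0, sq_nonneg (X r 3)]
  have e : ((n : ℝ) - 1) + 1 = n := by ring
  have hd : |X r 3| ≤ D :=
    (ledger_invariant_final hK0 (by positivity) (by linarith only [hn1]) hd1
      (by rw [e]; exact hd2)).trans hD
  exact ⟨r, θ, hr, hb, hθ, hθhi, hc, hP, hP50, hA, ha, hd⟩

end Summit.NavierStokesRegularity.FluidComputer.GateBudget

end
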